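import Literature.Topology.FourManifolds.MilnorLambdaPath
import Literature.Topology.FourManifolds.MorseHeightFunctions
import Mathlib.Analysis.Normed.Module.FiniteDimension
import Mathlib.Analysis.Normed.Ring.Units
import Mathlib.Topology.UniformSpace.HeineCantor
import HarnessLib

/-!
# Factorisation of orientation-preserving linear automorphisms into near-identity factors,
# and the block-triangular case

Topic `Literature/Topology/FourManifolds` (fact seat
`provefact-Literature.Topology.FourManifolds.Cobord-7d2044dc04`, tenure on
`Literature.Topology.FourManifolds.Cobordism.Milnor1965_cancellation_levelIsotopy`; second file
of a proof of Milnor's local **Theorem 5.6** (`Literature.Topology.FourManifolds.Milnor1965_localIsotopy`),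
after `RealisingGermIsotopy.lean`, whose realisation theorem
`Literature.Topology.FourManifolds.exists_ambientIsotopy_realising_germ` takes the derivative of
the germ factorised into near-identity linear factors preserving a subspace).  Everything here
is **proved**; no named facts.

Milnor, *Lectures on the h-cobordism theorem* (1965), proof of Lemma 5.7 (PDF p. 33), proves
that his family `Λ` is smoothly path connected by reducing a matrix `(A *; * *)` through block
row and column operations and then deforming the diagonal blocks inside `GL⁺`; the tree has
this as `Literature.Topology.FourManifolds.exists_path_of_det_pos` (`GL⁺(n, ℝ)` is smoothly path
connected) and `Literature.Topology.FourManifolds.exists_path_fromBlocks_of_det_pos`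
(`MilnorLambdaPath.lean`).  Here a continuous path in `GL⁺` is cut into short pieces, which
gives the multiplicative form of connectedness used by isotopies built from near-identity
steps (Hirsch, *Differential Topology* (1976), Ch. 8 §3, proof of Thm. 3.1):

* `exists_list_prod_eq_of_det_pos` — **every automorphism of `ℝⁿ` with positive determinant is
  a product of automorphisms `ε`-close to the identity**, for every `ε > 0`;
* `exists_list_prod_eq_of_snd_apply_inl_eq_zero` — the version for automorphisms `L` of a
  product `P × Q` of finite-dimensional spaces (Milnor's `Rᵃ × Rᵇ`) mapping `P × 0` into
  itself, with `det L > 0` and `det A > 0` for the block `A = pr_P ∘ L ∘ in_P` (the tree's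
  `Literature.Topology.FourManifolds.fstBlock L` when `P × Q = Rᵃ × Rᵇ`): the factors may be
  taken to map `P × 0` into itself as well.  (Block factorisation `L = (1 ⊕ B) ∘ U ∘ (A ⊕ 1)` with the
  shear `U(u, v) = (u + C v, v) = (U_{C/m})ᵐ` — the tree's
  `Literature.Topology.FourManifolds.HeightFunction.shear` of `MorseHeightFunctions.lean` —,
  `det B = det L / det A > 0` because `det U = (det U_{C/2})² > 0`, and the first result for
  `A` and `B`.)  The telescoping step `exists_list_prod_eq_of_det_pos_path` is the
  equiv-valued variant of the normed-ring lemma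
  `Literature.Topology.FourManifolds.exists_list_prod_eq_of_path` (`GompfConjInvariance.lean`,
  not imported here), to be merged by a later librarian pass.

## References

* J. Milnor, *Lectures on the h-cobordism theorem* (1965), proof of Lemma 5.7, Assertion
  (PDF p. 33). [MilnorHCobordism1965]
* M. W. Hirsch, *Differential Topology*, GTM 33 (1976), Ch. 8 §3, proof of Thm. 3.1 ("since
  `GL⁺(n)` is connected"). [HirschDT1976]
-/

open scoped Topology
open Function Set Filter Metric

noncomputable section

namespace Literature.Topology.FourManifolds

/-! ### Cutting a path in `GL⁺` into near-identity factors -/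

section General

variable {E : Type*} [NormedAddCommGroup E] [NormedSpace ℝ E] [FiniteDimensional ℝ E]

omit [FiniteDimensional ℝ E] in
/-- **Telescoping products along a path of automorphisms.**  For automorphisms `Q₀, Q₁, …` of
`E`, the product `(Q_k Q_{k-1}⁻¹) ⋯ (Q₂ Q₁⁻¹)(Q₁ Q₀⁻¹)` is `Q_k Q₀⁻¹`. [folklore] -/
theorem prod_telescope (Q : ℕ → E ≃L[ℝ] E) (k : ℕ) :
    ((List.range k).reverse.map fun i => Q (i + 1) * (Q i)⁻¹).prod = Q k * (Q 0)⁻¹ := by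
  induction k with
  | zero => simp
  | succ k ih =>
    rw [List.range_succ, List.reverse_append, List.reverse_singleton, List.singleton_append,
      List.map_cons, List.prod_cons, ih]
    group

/-- **A continuous path of automorphisms with positive determinant from `1` to `A` factors `A`
into near-identity automorphisms.**  If `P : ℝ → End(E)` is continuous with `det (P t) > 0`
for all `t`, `P 0 = 1` and `P 1 = A`, then for every `ε > 0`, `A` is a product of
automorphisms `M` with `‖M - 1‖ ≤ ε` (the factors `P(tᵢ) P(tᵢ₋₁)⁻¹` of a fine subdivision:
`t ↦ P(t)⁻¹` is bounded on `[0, 1]` and `P` is uniformly continuous there).  Equiv-valued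
variant of the tree's normed-ring lemma `Literature.Topology.FourManifolds.exists_list_prod_eq_of_path`
(`GompfConjInvariance.lean`).  Hirsch (1976), Ch. 8 §3, proof of Thm. 3.1. [folklore] -/
theorem exists_list_prod_eq_of_det_pos_path {P : ℝ → E →L[ℝ] E} (hP : Continuous P)
    (hdet : ∀ t, 0 < (P t).det) (hP0 : P 0 = 1) {A : E →L[ℝ] E} (hP1 : P 1 = A) {ε : ℝ}
    (hε : 0 < ε) :
    ∃ Ms : List (E ≃L[ℝ] E), (∀ M ∈ Ms, ‖(M : E →L[ℝ] E) - 1‖ ≤ ε) ∧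
      ((Ms.prod : E ≃L[ℝ] E) : E →L[ℝ] E) = A := by
  haveI : CompleteSpace E := FiniteDimensional.complete ℝ E
  -- the automorphisms `Q t = P t`
  set Q : ℝ → E ≃L[ℝ] E := fun t => (P t).toContinuousLinearEquivOfDetNeZero (hdet t).ne'
    with hQ
  have hQc : ∀ t, ((Q t : E ≃L[ℝ] E) : E →L[ℝ] E) = P t := fun t =>
    ContinuousLinearMap.coe_toContinuousLinearEquivOfDetNeZero _ _
  -- `t ↦ (Q t)⁻¹` is continuous, hence bounded on `[0, 1]`
  have hinv : ∀ t, ((Q t).symm : E →L[ℝ] E) = Ring.inverse (P t) := by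
    intro t
    have h1 : (((Q t).toUnit : (E →L[ℝ] E)ˣ) : E →L[ℝ] E) = P t := hQc t
    rw [← h1, Ring.inverse_unit]
    rfl
  have hinvc : Continuous fun t => ((Q t).symm : E →L[ℝ] E) := by
    simp_rw [hinv]
    refine continuous_iff_continuousAt.2 fun t => ?_
    have h1 : (((Q t).toUnit : (E →L[ℝ] E)ˣ) : E →L[ℝ] E) = P t := hQc t
    have h2 : ContinuousAt Ring.inverse (P t) := by
      rw [← h1]; exact NormedRing.inverse_continuousAt _
    exact h2.comp hP.continuousAt
  obtain ⟨B₀, hB₀⟩ := isCompact_Icc.exists_bound_of_continuousOn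
    (hinvc.continuousOn (s := Icc (0 : ℝ) 1))
  set B : ℝ := max B₀ 1 with hB
  have hB1 : 1 ≤ B := le_max_right _ _
  have hB0 : 0 < B := one_pos.trans_le hB1
  have hBb : ∀ t ∈ Icc (0 : ℝ) 1, ‖((Q t).symm : E →L[ℝ] E)‖ ≤ B := fun t ht =>
    (hB₀ t ht).trans (le_max_left _ _)
  -- uniform continuity of `P` on `[0, 1]`
  obtain ⟨δ, hδ, hδP⟩ := Metric.uniformContinuousOn_iff_le.1
    (isCompact_Icc.uniformContinuousOn_of_continuous (hP.continuousOn (s := Icc (0 : ℝ) 1)))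
    (ε / B) (by positivity)
  obtain ⟨m, hm⟩ := exists_nat_one_div_lt hδ
  set n : ℕ := m + 1 with hn
  have hn0 : (0 : ℝ) < n := by rw [hn]; positivity
  -- the sample points `tᵢ = i / n` and the factors `Q(tᵢ₊₁) Q(tᵢ)⁻¹`
  set Qn : ℕ → E ≃L[ℝ] E := fun i => Q (i / n) with hQn
  refine ⟨(List.range n).reverse.map fun i => Qn (i + 1) * (Qn i)⁻¹, ?_, ?_⟩
  · intro M hM
    obtain ⟨i, hi, rfl⟩ := List.mem_map.1 hM
    rw [List.mem_reverse, List.mem_range] at hi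
    have hi0 : (i : ℝ) / n ∈ Icc (0 : ℝ) 1 := by
      refine ⟨by positivity, ?_⟩
      rw [div_le_one hn0]
      exact_mod_cast hi.le
    have hi1 : ((i + 1 : ℕ) : ℝ) / n ∈ Icc (0 : ℝ) 1 := by
      refine ⟨by positivity, ?_⟩
      rw [div_le_one hn0]
      exact_mod_cast hi
    have hdist : dist (((i + 1 : ℕ) : ℝ) / n) ((i : ℝ) / n) ≤ δ := by
      rw [dist_eq_norm, Real.norm_eq_abs, Nat.cast_add_one, ← sub_div, add_sub_cancel_left,
        abs_of_pos (by positivity)]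
      rw [hn, Nat.cast_add_one]
      exact hm.le
    have key : ((Qn (i + 1) * (Qn i)⁻¹ : E ≃L[ℝ] E) : E →L[ℝ] E) - 1 =
        (P (((i + 1 : ℕ) : ℝ) / n) - P ((i : ℝ) / n)).comp ((Qn i).symm : E →L[ℝ] E) := by
      ext x
      simp only [hQn, _root_.sub_apply, ContinuousLinearMap.comp_apply, Nat.cast_add, Nat.cast_one]
      change Q (((i : ℝ) + 1) / n) ((Q ((i : ℝ) / n)).symm x) - x = _
      have h1 : P ((i : ℝ) / n) ((Q ((i : ℝ) / n)).symm x) = x := by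
        rw [← hQc]; exact (Q _).apply_symm_apply x
      rw [ContinuousLinearEquiv.coe_coe, h1, ← hQc]
      rfl
    rw [key]
    calc ‖(P (((i + 1 : ℕ) : ℝ) / n) - P ((i : ℝ) / n)).comp ((Qn i).symm : E →L[ℝ] E)‖
        ≤ ‖P (((i + 1 : ℕ) : ℝ) / n) - P ((i : ℝ) / n)‖ * ‖((Qn i).symm : E →L[ℝ] E)‖ :=
          ContinuousLinearMap.opNorm_comp_le _ _
      _ ≤ ε / B * B := by
          refine mul_le_mul ?_ (hBb _ hi0) (norm_nonneg _) (by positivity)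
          have := hδP _ hi1 _ hi0 hdist
          rwa [dist_eq_norm] at this
      _ = ε := by field_simp
  · rw [prod_telescope]
    have h0 : Qn 0 = 1 := by
      ext x
      change Q ((0 : ℕ) / n) x = x
      rw [← ContinuousLinearEquiv.coe_coe, hQc]
      simp [hP0]
    have h1 : ((Qn n : E ≃L[ℝ] E) : E →L[ℝ] E) = A := by
      rw [← hP1]
      change ((Q ((n : ℕ) / n) : E ≃L[ℝ] E) : E →L[ℝ] E) = P 1
      rw [hQc, div_self hn0.ne']
    rw [h0, inv_one, mul_one, h1]

/-- **Every automorphism of a finite-dimensional real normed space with positive determinant is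
a product of automorphisms `ε`-close to the identity** (`GL⁺` is connected, in multiplicative
form): by `Literature.Topology.FourManifolds.exists_path_of_det_pos` (Milnor's *"as is well
known"*, PDF p. 33: Gaussian elimination) there is a continuous path of matrices of positive
determinant from `1` to the matrix of `A`, which `exists_list_prod_eq_of_det_pos_path` cuts into
near-identity factors. [cite: MilnorHCobordism1965, proof of Lemma 5.7, Assertion (PDF p. 33)] -/
theorem exists_list_prod_eq_of_det_pos (A : E →L[ℝ] E) (hA : 0 < A.det) {ε : ℝ} (hε : 0 < ε) :
    ∃ Ms : List (E ≃L[ℝ] E), (∀ M ∈ Ms, ‖(M : E →L[ℝ] E) - 1‖ ≤ ε) ∧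
      ((Ms.prod : E ≃L[ℝ] E) : E →L[ℝ] E) = A := by
  classical
  set b := Module.finBasis ℝ E with hb
  set Am : Matrix (Fin (Module.finrank ℝ E)) (Fin (Module.finrank ℝ E)) ℝ :=
    LinearMap.toMatrix b b (A : E →ₗ[ℝ] E) with hAm
  have hdetAm : 0 < Am.det := by rw [hAm, LinearMap.det_toMatrix]; exact hA
  obtain ⟨γ, hγ, hγ0, hγ1, hγpos⟩ := exists_path_of_det_pos Am hdetAm
  -- the linear identification `Matrix ↦ End(E)` and the clamped, reversed path
  set Φ : Matrix (Fin (Module.finrank ℝ E)) (Fin (Module.finrank ℝ E)) ℝ →ₗ[ℝ] (E →L[ℝ] E) :=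
    (LinearMap.toContinuousLinearMap : (E →ₗ[ℝ] E) ≃ₗ[ℝ] (E →L[ℝ] E)).toLinearMap ∘ₗ
      (Matrix.toLin b b).toLinearMap with hΦ
  have hΦapply : ∀ N, Φ N = LinearMap.toContinuousLinearMap (Matrix.toLin b b N) := fun N => rfl
  have hΦc : Continuous Φ := LinearMap.continuous_of_finiteDimensional Φ
  set P : ℝ → E →L[ℝ] E := fun t => Φ (γ (1 - projIcc (0 : ℝ) 1 zero_le_one t)) with hP
  have hγc : Continuous γ := continuous_matrix fun i j => (hγ i j).continuous
  have hPc : Continuous P :=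
    hΦc.comp (hγc.comp (continuous_const.sub (continuous_subtype_val.comp continuous_projIcc)))
  have hPdet : ∀ t, 0 < (P t).det := by
    intro t
    have hmem : 1 - (projIcc (0 : ℝ) 1 zero_le_one t : ℝ) ∈ Icc (0 : ℝ) 1 := by
      have := (projIcc (0 : ℝ) 1 zero_le_one t).2
      constructor <;> linarith [this.1, this.2]
    have := hγpos _ hmem
    simp only [hP, hΦapply, ContinuousLinearMap.det, LinearMap.coe_toContinuousLinearMap,
      LinearMap.det_toLin]
    exact this
  have hP0 : P 0 = 1 := by
    apply ContinuousLinearMap.coe_injective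
    simp only [hP, hΦapply, LinearMap.coe_toContinuousLinearMap, projIcc_left,
      sub_zero, hγ1, Matrix.toLin_one]
    rfl
  have hP1 : P 1 = A := by
    apply ContinuousLinearMap.coe_injective
    simp only [hP, hΦapply, LinearMap.coe_toContinuousLinearMap, projIcc_right,
      sub_self, hγ0, hAm, Matrix.toLin_toMatrix]
  exact exists_list_prod_eq_of_det_pos_path hPc hPdet hP0 hP1 hε

end General

/-! ### The block-triangular case on a product `P × Q` (Milnor's `Rᵃ × Rᵇ`) -/

section Block

open HeightFunction

variable {P Q : Type*} [NormedAddCommGroup P] [NormedSpace ℝ P]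
  [NormedAddCommGroup Q] [NormedSpace ℝ Q]

/-- `U_C x - x = (C v, 0)` for the shear `U_C = HeightFunction.shear C` of the tree,
`(u, v) ↦ (u + C v, v)` (`MorseHeightFunctions.lean`). [folklore] -/
theorem shear_apply_sub (C : Q →L[ℝ] P) (x : P × Q) :
    shear C x - x = (C x.2, 0) := by
  rw [shear_apply]
  exact Prod.ext (by simp) (by simp)

/-- `U_C - 1` has norm `≤ ‖C‖`. [folklore] -/
theorem norm_shear_sub_one_le (C : Q →L[ℝ] P) :
    ‖((shear C : (P × Q) ≃L[ℝ] (P × Q)) : (P × Q) →L[ℝ] (P × Q)) - 1‖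
      ≤ ‖C‖ := by
  refine ContinuousLinearMap.opNorm_le_bound _ (norm_nonneg _) fun x => ?_
  rw [_root_.sub_apply, ContinuousLinearEquiv.coe_coe, one_apply_eq_self,
    shear_apply_sub, Prod.norm_def]
  simp only [norm_zero]
  rw [max_eq_left (norm_nonneg _)]
  exact (C.le_opNorm x.2).trans (mul_le_mul_of_nonneg_left (norm_snd_le x) (norm_nonneg _))

/-- Shears compose additively: `U_C ∘ U_D = U_{C + D}`. [folklore] -/
theorem shear_mul_shear (C D : Q →L[ℝ] P) :
    shear C * shear D = shear (C + D) := by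
  refine ContinuousLinearEquiv.ext (funext fun x => ?_)
  change shear C (shear D x) = shear (C + D) x
  rw [shear_apply, shear_apply, shear_apply]
  refine Prod.ext ?_ rfl
  simp only [_root_.add_apply]
  abel

/-- Powers of a shear: `(U_C)ᵐ = U_{m C}`. [folklore] -/
theorem shear_pow (C : Q →L[ℝ] P) (m : ℕ) :
    shear C ^ m = shear ((m : ℝ) • C) := by
  induction m with
  | zero =>
    rw [pow_zero]
    refine ContinuousLinearEquiv.ext (funext fun x => ?_)
    rw [shear_apply]
    change x = _
    exact Prod.ext (by simp) rfl
  | succ m ih =>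
    rw [pow_succ, ih, shear_mul_shear]
    congr 1
    ext1 v
    simp only [_root_.add_apply, _root_.smul_apply, Nat.cast_succ]
    module

/-- A shear has positive determinant: `det U_C = (det U_{C/2})² > 0`. [folklore] -/
theorem det_shear_pos (C : Q →L[ℝ] P) :
    0 < ((shear C : (P × Q) ≃L[ℝ] (P × Q)) : (P × Q) →L[ℝ] (P × Q)).det := by
  set H : (P × Q) ≃L[ℝ] (P × Q) := shear ((2⁻¹ : ℝ) • C) with hH
  have h : shear C = H * H := by
    rw [hH, shear_mul_shear]
    congr 1
    ext1 v
    simp only [_root_.add_apply, _root_.smul_apply]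
    module
  have hne : ((H : (P × Q) ≃L[ℝ] (P × Q)) : (P × Q) →L[ℝ] (P × Q)).det ≠ 0 :=
    (LinearEquiv.isUnit_det' H.toLinearEquiv).ne_zero
  rw [h]
  change 0 < LinearMap.det (((H * H : (P × Q) ≃L[ℝ] (P × Q)) :
    (P × Q) →L[ℝ] (P × Q)) : (P × Q) →ₗ[ℝ] (P × Q))
  have : (((H * H : (P × Q) ≃L[ℝ] (P × Q)) : (P × Q) →L[ℝ] (P × Q)) :
      (P × Q) →ₗ[ℝ] (P × Q)) =
      ((H : (P × Q) ≃L[ℝ] (P × Q)) : (P × Q) →ₗ[ℝ] (P × Q)) ∘ₗ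
        ((H : (P × Q) ≃L[ℝ] (P × Q)) : (P × Q) →ₗ[ℝ] (P × Q)) := rfl
  rw [this, LinearMap.det_comp]
  exact mul_self_pos.2 hne

/-- Embedding an automorphism of the first factor as `N ⊕ 1`: the distance to the identity does not
increase. [folklore] -/
theorem norm_prodCongr_one_sub_one_le (N : P ≃L[ℝ] P) :
    ‖((N.prodCongr (1 : Q ≃L[ℝ] Q) : (P × Q) ≃L[ℝ] (P × Q)) :
        (P × Q) →L[ℝ] (P × Q)) - 1‖ ≤ ‖(N : P →L[ℝ] P) - 1‖ := by
  refine ContinuousLinearMap.opNorm_le_bound _ (norm_nonneg _) fun x => ?_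
  have h1 : (((N.prodCongr (1 : Q ≃L[ℝ] Q) : (P × Q) ≃L[ℝ] (P × Q)) :
      (P × Q) →L[ℝ] (P × Q)) - 1) x = (((N : P →L[ℝ] P) - 1) x.1, 0) := by
    change (N x.1, x.2) - x = (N x.1 - x.1, 0)
    exact Prod.ext rfl (sub_self _)
  rw [h1, Prod.norm_def]
  simp only [norm_zero]
  rw [max_eq_left (norm_nonneg _)]
  exact (((N : P →L[ℝ] P) - 1).le_opNorm x.1).trans
    (mul_le_mul_of_nonneg_left (norm_fst_le x) (norm_nonneg _))

/-- Embedding an automorphism of the second factor as `1 ⊕ N`: the distance to the identity does not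
increase. [folklore] -/
theorem norm_one_prodCongr_sub_one_le (N : Q ≃L[ℝ] Q) :
    ‖(((1 : P ≃L[ℝ] P).prodCongr N : (P × Q) ≃L[ℝ] (P × Q)) :
        (P × Q) →L[ℝ] (P × Q)) - 1‖ ≤ ‖(N : Q →L[ℝ] Q) - 1‖ := by
  refine ContinuousLinearMap.opNorm_le_bound _ (norm_nonneg _) fun x => ?_
  have h1 : ((((1 : P ≃L[ℝ] P).prodCongr N : (P × Q) ≃L[ℝ] (P × Q)) :
      (P × Q) →L[ℝ] (P × Q)) - 1) x = (0, ((N : Q →L[ℝ] Q) - 1) x.2) := by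
    change (x.1, N x.2) - x = (0, N x.2 - x.2)
    exact Prod.ext (sub_self _) rfl
  rw [h1, Prod.norm_def]
  simp only [norm_zero]
  rw [max_eq_right (norm_nonneg _)]
  exact (((N : Q →L[ℝ] Q) - 1).le_opNorm x.2).trans
    (mul_le_mul_of_nonneg_left (norm_snd_le x) (norm_nonneg _))

/-- Products of embedded automorphisms `N ⊕ 1`. [folklore] -/
theorem prod_map_prodCongr_one (Ns : List (P ≃L[ℝ] P)) :
    (Ns.map fun N => N.prodCongr (1 : Q ≃L[ℝ] Q)).prod = (Ns.prod).prodCongr 1 := by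
  induction Ns with
  | nil => exact ContinuousLinearEquiv.ext (funext fun x => rfl)
  | cons N Ns ih =>
    rw [List.map_cons, List.prod_cons, List.prod_cons, ih]
    exact ContinuousLinearEquiv.ext (funext fun x => rfl)

/-- Products of embedded automorphisms `1 ⊕ N`. [folklore] -/
theorem prod_map_one_prodCongr (Ns : List (Q ≃L[ℝ] Q)) :
    (Ns.map fun N => (1 : P ≃L[ℝ] P).prodCongr N).prod = (1 : P ≃L[ℝ] P).prodCongr Ns.prod := by
  induction Ns with
  | nil => exact ContinuousLinearEquiv.ext (funext fun x => rfl)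
  | cons N Ns ih =>
    rw [List.map_cons, List.prod_cons, List.prod_cons, ih]
    exact ContinuousLinearEquiv.ext (funext fun x => rfl)

/-- **Near-identity factorisation of block-triangular automorphisms.**  Let `L` be an
automorphism of `P × Q` (finite-dimensional; Milnor's `Rᵃ × Rᵇ`) mapping `P × 0` into itself,
with `det L > 0` and `det A > 0` for its block `A = pr_P ∘ L ∘ in_P` (`u ↦ pr_P L(u, 0)`,
the tree's `fstBlock L` on `Rᵃ × Rᵇ`).  Then for every `ε > 0`, `L` is a product of
automorphisms `M` with `‖M - 1‖ ≤ ε`, each mapping `P × 0` into itself.  Proof: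
`L = (1 ⊕ B) ∘ U_C ∘ (A ⊕ 1)` with `B v = pr_b L(0, v)`, `C v = pr_a L(0, v)`; `det U_C > 0`
(`det_shear_pos`), so `det B > 0`, and `A`, `B` factor by
`exists_list_prod_eq_of_det_pos`, `U_C = (U_{C/m})ᵐ`.  (Milnor's reduction of `(A *; 0 B)`,
proof of Lemma 5.7, PDF p. 33, in multiplicative form.)
[cite: MilnorHCobordism1965, proof of Lemma 5.7, Assertion (PDF p. 33)] -/
theorem exists_list_prod_eq_of_snd_apply_inl_eq_zero [FiniteDimensional ℝ P] [FiniteDimensional ℝ Q]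
    (L : (P × Q) ≃L[ℝ] (P × Q))
    (hLS : ∀ u : P, (L (u, 0)).2 = 0)
    (hdet : 0 < ((L : (P × Q) ≃L[ℝ] (P × Q)) : (P × Q) →L[ℝ] (P × Q)).det)
    (hA : 0 < LinearMap.det ((ContinuousLinearMap.fst ℝ P Q).comp
      (((L : (P × Q) ≃L[ℝ] (P × Q)) : (P × Q) →L[ℝ] (P × Q)).comp (ContinuousLinearMap.inl ℝ P Q)) :
        P →ₗ[ℝ] P))
    {ε : ℝ} (hε : 0 < ε) :
    ∃ Ms : List ((P × Q) ≃L[ℝ] (P × Q)),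
      (∀ M ∈ Ms, ‖(M : (P × Q) →L[ℝ] (P × Q)) - 1‖ ≤ ε) ∧
      (∀ M ∈ Ms, ∀ u : P, (M (u, 0)).2 = 0) ∧ Ms.prod = L := by
  -- the blocks
  set A : P →L[ℝ] P := (ContinuousLinearMap.fst ℝ P Q).comp
    (((L : (P × Q) ≃L[ℝ] (P × Q)) : (P × Q) →L[ℝ] (P × Q)).comp (ContinuousLinearMap.inl ℝ P Q)) with hAdef
  set B : Q →L[ℝ] Q := (ContinuousLinearMap.snd ℝ (P) (Q)).comp
    ((L : (P × Q) →L[ℝ] (P × Q)).comp (ContinuousLinearMap.inr ℝ (P) (Q))) with hBdef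
  set C : Q →L[ℝ] P := (ContinuousLinearMap.fst ℝ (P) (Q)).comp
    ((L : (P × Q) →L[ℝ] (P × Q)).comp (ContinuousLinearMap.inr ℝ (P) (Q))) with hCdef
  have hAu : ∀ u, A u = (L (u, 0)).1 := fun u => rfl
  have hBv : ∀ v, B v = (L (0, v)).2 := fun v => rfl
  have hCv : ∀ v, C v = (L (0, v)).1 := fun v => rfl
  have hLuv : ∀ x : P × Q, L x = (A x.1 + C x.2, B x.2) := by
    rintro ⟨u, v⟩
    have h1 : L (u, v) = L (u, 0) + L (0, v) := by
      rw [← map_add, Prod.mk_add_mk, add_zero, zero_add]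
    rw [h1, hAu, hBv, hCv]
    refine Prod.ext ?_ ?_
    · simp
    · simp [hLS u]
  -- `det L = det B · det U_C · det A`, `det U_C > 0`, so `det B > 0`
  have hL : ((L : (P × Q) ≃L[ℝ] (P × Q)) : (P × Q) →L[ℝ] (P × Q)) =
      (((1 : P →L[ℝ] P).prodMap B).comp
        (((shear C : (P × Q) ≃L[ℝ] (P × Q)) : (P × Q) →L[ℝ] (P × Q)).comp
          (A.prodMap (1 : Q →L[ℝ] Q)))) := by
    refine ContinuousLinearMap.ext fun x => ?_
    change L x = ((1 : P →L[ℝ] P).prodMap B) (shear C ((A.prodMap (1 : Q →L[ℝ] Q)) x))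
    rw [hLuv, shear_apply]
    rfl
  have hdet' : ((L : (P × Q) ≃L[ℝ] (P × Q)) : (P × Q) →L[ℝ] (P × Q)).det =
      B.det * ((((shear C : (P × Q) ≃L[ℝ] (P × Q)) :
        (P × Q) →L[ℝ] (P × Q)).det) * A.det) := by
    rw [hL]
    change LinearMap.det ((( ((1 : P →L[ℝ] P).prodMap B).comp
        (((shear C : (P × Q) ≃L[ℝ] (P × Q)) : (P × Q) →L[ℝ] (P × Q)).comp
          (A.prodMap (1 : Q →L[ℝ] Q)))) : (P × Q) →L[ℝ] (P × Q)) :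
            (P × Q) →ₗ[ℝ] (P × Q)) = _
    rw [ContinuousLinearMap.toLinearMap_comp, LinearMap.det_comp, ContinuousLinearMap.toLinearMap_comp,
      LinearMap.det_comp, ContinuousLinearMap.coe_prodMap, LinearMap.det_prodMap,
      ContinuousLinearMap.coe_prodMap, LinearMap.det_prodMap,
      ContinuousLinearMap.toLinearMap_one, ContinuousLinearMap.toLinearMap_one, map_one, map_one,
      one_mul, mul_one]
  have hdetB : 0 < B.det := by
    have hU := det_shear_pos C
    rw [hdet'] at hdet
    have h2 : 0 < ((((shear C : (P × Q) ≃L[ℝ] (P × Q)) :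
        (P × Q) →L[ℝ] (P × Q)).det) * A.det) := mul_pos hU hA
    exact pos_of_mul_pos_left hdet h2.le
  -- the automorphisms `A`, `B`
  set A' : P ≃L[ℝ] P := A.toContinuousLinearEquivOfDetNeZero hA.ne' with hA'def
  have hA' : (A' : P →L[ℝ] P) = A := ContinuousLinearMap.coe_toContinuousLinearEquivOfDetNeZero _ _
  set B' : Q ≃L[ℝ] Q := B.toContinuousLinearEquivOfDetNeZero hdetB.ne' with hB'def
  have hB' : (B' : Q →L[ℝ] Q) = B := ContinuousLinearMap.coe_toContinuousLinearEquivOfDetNeZero _ _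
  have hA'x : ∀ u, A' u = A u := fun u => by rw [← hA']; rfl
  have hB'x : ∀ v, B' v = B v := fun v => by rw [← hB']; rfl
  have hfac : ∀ x, L x = ((1 : P ≃L[ℝ] P).prodCongr B')
      (shear C ((A'.prodCongr (1 : Q ≃L[ℝ] Q)) x)) := by
    intro x
    rw [ContinuousLinearEquiv.prodCongr_apply, shear_apply,
      ContinuousLinearEquiv.prodCongr_apply, hLuv, hA'x, hB'x]
    rfl
  have hdetA'' : 0 < (A' : P →L[ℝ] P).det := by rw [hA']; exact hA
  have hdetB'' : 0 < (B' : Q →L[ℝ] Q).det := by rw [hB']; exact hdetB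
  obtain ⟨NsA, hNsA, hNsAprod⟩ := exists_list_prod_eq_of_det_pos (A' : P →L[ℝ] P) hdetA'' hε
  obtain ⟨NsB, hNsB, hNsBprod⟩ := exists_list_prod_eq_of_det_pos (B' : Q →L[ℝ] Q) hdetB'' hε
  have hNsA' : NsA.prod = A' := ContinuousLinearEquiv.coe_injective hNsAprod
  have hNsB' : NsB.prod = B' := ContinuousLinearEquiv.coe_injective hNsBprod
  -- the factors of the shear
  obtain ⟨m, hm⟩ : ∃ m : ℕ, ‖C‖ / ε < m := exists_nat_gt _
  have hm0 : (0 : ℝ) < m := lt_of_le_of_lt (by positivity) hm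
  have hm1 : (m : ℝ) ≠ 0 := hm0.ne'
  set Cm : Q →L[ℝ] P := (m : ℝ)⁻¹ • C with hCm
  have hUpow : shear Cm ^ m = shear C := by
    rw [shear_pow, hCm, smul_smul, mul_inv_cancel₀ hm1, one_smul]
  -- assemble
  refine ⟨(NsB.map fun N => (1 : P ≃L[ℝ] P).prodCongr N) ++
      (List.replicate m (shear Cm) ++ NsA.map fun N => N.prodCongr (1 : Q ≃L[ℝ] Q)),
    ?_, ?_, ?_⟩
  · intro M hM
    simp only [List.mem_append, List.mem_map, List.mem_replicate] at hM
    rcases hM with ⟨N, hN, rfl⟩ | ⟨-, rfl⟩ | ⟨N, hN, rfl⟩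
    · exact (norm_one_prodCongr_sub_one_le N).trans (hNsB N hN)
    · refine (norm_shear_sub_one_le Cm).trans ?_
      rw [hCm, norm_smul, norm_inv, Real.norm_natCast, inv_mul_le_iff₀ hm0]
      rw [div_lt_iff₀ hε] at hm
      linarith
    · exact (norm_prodCongr_one_sub_one_le N).trans (hNsA N hN)
  · intro M hM u
    simp only [List.mem_append, List.mem_map, List.mem_replicate] at hM
    rcases hM with ⟨N, hN, rfl⟩ | ⟨-, rfl⟩ | ⟨N, hN, rfl⟩
    · rw [ContinuousLinearEquiv.prodCongr_apply, map_zero]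
    · rw [shear_apply]
    · rw [ContinuousLinearEquiv.prodCongr_apply]; rfl
  · rw [List.prod_append, List.prod_append, List.prod_replicate, hUpow, prod_map_one_prodCongr,
      prod_map_prodCongr_one, hNsA', hNsB']
    refine ContinuousLinearEquiv.ext (funext fun x => ?_)
    change ((1 : P ≃L[ℝ] P).prodCongr B') (shear C ((A'.prodCongr 1) x)) = L x
    exact (hfac x).symm

end Block

end Literature.Topology.FourManifolds
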